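import Summits.CriticalPhenomena.CardyFormulaZ2.Theses.CardyBondTriangular

/-!
# `ApproxDiscreteCauchy` (item stmt-CriticalPhenomena-4668) — proved, with `C = 3`

Route `CardyBondTriangular`, support item `ApproxDiscreteCauchy`: Bollobás–Riordan's Lemma 13
(*Percolation*, CUP 2006, Ch. 7, pp. 181–182), the deterministic summation by parts, in the
format of `Literature.Probability.Percolation.norm_discreteTriangleIntegral_sub_mul_le`
(arbitrary `F` on the face centres and `g` on pairs of adjacent faces of `δ𝕋` inside a lattice
triangular contour with `n` edges per side; (10) exact, (12) `|g| ≤ ε`) but with the exact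
colour-switching identity (14) `g^{i+1}(w, z_{j+1}) = g^i(w, z_j)` replaced by the APPROXIMATE one
`|g^{i+1}(w, z_{j+1}) - g^i(w, z_j)| ≤ η` at every face inside the contour. The discrete Cauchy
defect is then

  `‖∮ᴰ_C F^{i+1} dz - ω ∮ᴰ_C F^i dz‖ ≤ 6 n δ ε + 3 n² δ η`,

i.e. the route statement holds with the absolute constant `C = 3` (`n²` interior faces × three
dual edges of length `δ/√3` × `|2ζ - 1| = √3`).

Proof: that of `norm_discreteTriangleIntegral_sub_mul_le(_local)` with (15) `S_{i+1} = ω S_i`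
replaced by `‖(2ζ - 1)(S_{i+1} - ω S_i)‖ ≤ 3 · #C° · |s| · η` — after the re-indexing
`j ↦ j + 1` and the rotation (13), `S_{i+1} - ω S_i = Σ_{w ∈ C°} Σ_j ω (z_j - w)
(g^{i+1}(w, z_{j+1}) - g^i(w, z_j))`, each term being `s · (±u ω^{j+1}) · (…)` with
`‖(2ζ - 1) u‖ = 1` — together with `#C° ≤ n²` (`card_localInterior_le`), followed by the same
assembly, which without (15) reads
`∮ᴰ F^{i+1} - ω ∮ᴰ F^i = (2ζ - 1)(S_{i+1} - ω S_i) + (ω (2ζ - 1) S''_i - (2ζ - 1) S''_{i+1})`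
((16): `‖(2ζ - 1) S''_i‖ ≤ 3 n |s| ε`; (17) with (10): `S'_i = c ∮ᴰ F^i`, `(2ζ - 1) c = 1`).
The transfer from local coordinates to the faces of `δ𝕋` (both signs `s = ± δ`) is verbatim
that of the Literature file (`localToHex`, `localToHexNeg`).

## References

* B. Bollobás, O. Riordan, *Percolation*, Cambridge University Press (2006), Ch. 7, Lemma 13,
  pp. 181–182, (10)–(17).
-/

noncomputable section

open Finset Complex
open scoped BigOperators

namespace Summit.CriticalPhenomena.CardyFormulaZ2.Theorems

open Literature.Probability.Percolation Literature.Probability.LatticeModels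

/-- **`#C° ≤ n²`**: the faces inside a lattice triangular contour with `n` edges per side
(`localInterior n`: `a, b ≥ 0`, `a + b + t + 1 ≤ n`) number at most `n²` (in fact exactly
`n²`): `(a, b, 0) ↦ (a, b)` and `(a, b, 1) ↦ (n - 1 - a, n - 1 - b)` map `C°` injectively into
`[0, n) × [0, n)` (the images of the two types have `a + b ≤ n - 1`, resp. `≥ n`). -/
theorem card_localInterior_le (n : ℕ) : (localInterior n).card ≤ n ^ 2 := by
  classical
  let f : LocalFace → ℤ × ℤ := fun κ =>
    if κ.2.2 = 0 then (κ.1, κ.2.1) else ((n : ℤ) - 1 - κ.1, (n : ℤ) - 1 - κ.2.1)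
  have hmaps : Set.MapsTo f ↑(localInterior n)
      ↑(Finset.Ico (0 : ℤ) n ×ˢ Finset.Ico (0 : ℤ) n) := by
    intro κ hκ
    obtain ⟨a, b, t⟩ := κ
    rw [Finset.mem_coe, mem_localInterior] at hκ
    rw [Finset.mem_coe, Finset.mem_product, Finset.mem_Ico, Finset.mem_Ico]
    fin_cases t <;> simp [f] at hκ ⊢ <;> omega
  have hinj : Set.InjOn f ↑(localInterior n) := by
    rintro ⟨a, b, t⟩ hκ ⟨a', b', t'⟩ hκ' h
    rw [Finset.mem_coe, mem_localInterior] at hκ hκ'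
    fin_cases t <;> fin_cases t' <;> simp [f, Prod.ext_iff] at hκ hκ' h ⊢ <;> omega
  have h := Finset.card_le_card_of_injOn f hmaps hinj
  simpa [Finset.card_product, Int.card_Ico, sq] using h

/-- **Bollobás–Riordan's Lemma 13 with a colour-switching defect, in local coordinates.** Let
`C : p → p + n s → p + n s ζ → p` be a lattice triangular contour, `F : Fin 3 → ℂ → ℝ` read at
the centres of the faces inside `C` and `g : Fin 3 → C° → faces → ℝ` with, at every `w ∈ C°`
(neighbours `z_j` in anticlockwise order), the APPROXIMATE (14)
`|g^{i+1}(w, z_{j+1}) - g^i(w, z_j)| ≤ η`, (10) `F^i(z) - F^i(w) = g^i(w, z) - g^i(z, w)` for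
adjacent `w, z ∈ C°`, and (12) `|g^i(w, z)| ≤ ε`. Then
`‖∮ᴰ_C F^{i+1} dz - ω ∮ᴰ_C F^i dz‖ ≤ 6 n |s| ε + 3 n² |s| η`, `ω = ζ²`: as in the proof of
Lemma 13 (Bollobás–Riordan 2006, pp. 181–182), except that (15) `S_{i+1} = ω S_i` becomes
`‖(2ζ - 1)(S_{i+1} - ω S_i)‖ ≤ 3 #C° |s| η ≤ 3 n² |s| η`. -/
theorem norm_discreteTriangleIntegral_sub_mul_le_local_approx (F : Fin 3 → ℂ → ℝ)
    (g : Fin 3 → LocalFace → LocalFace → ℝ) (p : ℂ) (s : ℝ) (n : ℕ) {ε η : ℝ}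
    (h14 : ∀ κ ∈ localInterior n, ∀ i j : Fin 3,
      |g (i + 1) κ (localFaceNbr κ (j + 1)) - g i κ (localFaceNbr κ j)| ≤ η)
    (h10 : ∀ κ ∈ localInterior n, ∀ j : Fin 3, localFaceNbr κ j ∈ localInterior n → ∀ i : Fin 3,
      F i (localFaceCentre p s (localFaceNbr κ j)) - F i (localFaceCentre p s κ) =
        g i κ (localFaceNbr κ j) - g i (localFaceNbr κ j) κ)
    (h12 : ∀ κ ∈ localInterior n, ∀ i j : Fin 3, |g i κ (localFaceNbr κ j)| ≤ ε)
    (i : Fin 3) :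
    ‖discreteTriangleIntegral (F (i + 1)) p s n -
        triZeta ^ 2 * discreteTriangleIntegral (F i) p s n‖ ≤
      6 * n * |s| * ε + 3 * n ^ 2 * |s| * η := by
  -- the sums `S_i = S'_i + S''_i` of Bollobás–Riordan, p. 182
  set S : Fin 3 → ℂ := fun i => ∑ q ∈ localPairs n,
    (localFaceCentre p s (localFaceNbr q.1 q.2) - localFaceCentre p s q.1) *
      (g i q.1 (localFaceNbr q.1 q.2) : ℂ) with hS
  set So : Fin 3 → ℂ := fun i => ∑ q ∈ outerPairs n,
    (localFaceCentre p s (localFaceNbr q.1 q.2) - localFaceCentre p s q.1) *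
      (g i q.1 (localFaceNbr q.1 q.2) : ℂ) with hSo
  set Si : Fin 3 → ℂ := fun i => ∑ q ∈ innerPairs n,
    (localFaceCentre p s (localFaceNbr q.1 q.2) - localFaceCentre p s q.1) *
      (g i q.1 (localFaceNbr q.1 q.2) : ℂ) with hSi
  have hsplit : ∀ i, S i = Si i + So i := fun i =>
    sum_localPairs_eq_inner_add_outer n _
  -- (15), approximately: `‖(2ζ - 1)(S_{i+1} - ω S_i)‖ ≤ 3 n² |s| η`
  have h15 : ‖(2 * triZeta - 1) * (S (i + 1) - triZeta ^ 2 * S i)‖ ≤ 3 * n ^ 2 * |s| * η := by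
    -- re-index `j ↦ j + 1` in `S_{i+1}` and use the rotation (13)
    have e : ∀ κ : LocalFace,
        ∑ j : Fin 3, (localFaceCentre p s (localFaceNbr κ j) - localFaceCentre p s κ) *
            (g (i + 1) κ (localFaceNbr κ j) : ℂ) =
          ∑ j : Fin 3, triZeta ^ 2 *
            (localFaceCentre p s (localFaceNbr κ j) - localFaceCentre p s κ) *
              (g (i + 1) κ (localFaceNbr κ (j + 1)) : ℂ) := by
      intro κ
      rw [← Equiv.sum_comp (Equiv.addRight (1 : Fin 3))]
      simp only [Equiv.coe_addRight]
      refine Finset.sum_congr rfl fun j _ => ?_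
      rw [localFaceCentre_nbr_succ_sub]
    have hA : S (i + 1) = ∑ κ ∈ localInterior n, ∑ j : Fin 3, triZeta ^ 2 *
        (localFaceCentre p s (localFaceNbr κ j) - localFaceCentre p s κ) *
          (g (i + 1) κ (localFaceNbr κ (j + 1)) : ℂ) := by
      simp only [hS, localPairs, Finset.sum_product]
      exact Finset.sum_congr rfl fun κ _ => e κ
    have hB : S i = ∑ κ ∈ localInterior n, ∑ j : Fin 3,
        (localFaceCentre p s (localFaceNbr κ j) - localFaceCentre p s κ) *
          (g i κ (localFaceNbr κ j) : ℂ) := by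
      simp only [hS, localPairs, Finset.sum_product]
    have hrew : (2 * triZeta - 1) * (S (i + 1) - triZeta ^ 2 * S i) =
        ∑ κ ∈ localInterior n, ∑ j : Fin 3, (2 * triZeta - 1) * (triZeta ^ 2 *
          (localFaceCentre p s (localFaceNbr κ j) - localFaceCentre p s κ) *
            ((g (i + 1) κ (localFaceNbr κ (j + 1)) : ℂ) - g i κ (localFaceNbr κ j))) := by
      rw [hA, hB, Finset.mul_sum, ← Finset.sum_sub_distrib, Finset.mul_sum]
      refine Finset.sum_congr rfl fun κ _ => ?_
      rw [Finset.mul_sum, ← Finset.sum_sub_distrib, Finset.mul_sum]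
      refine Finset.sum_congr rfl fun j _ => ?_
      ring
    -- each of the `3 #C°` terms has modulus `≤ |s| η`
    have hterm : ∀ κ ∈ localInterior n, ∀ j : Fin 3,
        ‖(2 * triZeta - 1) * (triZeta ^ 2 *
          (localFaceCentre p s (localFaceNbr κ j) - localFaceCentre p s κ) *
            ((g (i + 1) κ (localFaceNbr κ (j + 1)) : ℂ) - g i κ (localFaceNbr κ j)))‖ ≤
          |s| * η := by
      intro κ hκ j
      rw [localFaceCentre_nbr_sub,
        show (2 * triZeta - 1) * (triZeta ^ 2 * ((s : ℂ) * (localFaceSign κ * hexStep *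
            (triZeta ^ 2) ^ (j : ℕ))) *
            ((g (i + 1) κ (localFaceNbr κ (j + 1)) : ℂ) - g i κ (localFaceNbr κ j))) =
          (s : ℂ) * (((2 * triZeta - 1) * hexStep) * ((localFaceSign κ *
            (triZeta ^ 2) ^ ((j : ℕ) + 1)) *
              ((g (i + 1) κ (localFaceNbr κ (j + 1)) - g i κ (localFaceNbr κ j) : ℝ) : ℂ))) by
          push_cast; ring,
        norm_mul, norm_mul, norm_two_triZeta_sub_one_mul_hexStep, one_mul, norm_mul, norm_mul,
        norm_localFaceSign, one_mul, norm_triZeta_sq_pow, one_mul, Complex.norm_real,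
        Complex.norm_real, Real.norm_eq_abs, Real.norm_eq_abs]
      exact mul_le_mul_of_nonneg_left (h14 κ hκ i j) (abs_nonneg _)
    rw [hrew]
    rcases Nat.eq_zero_or_pos n with rfl | hn
    · -- no faces inside a contour with no edges
      have h0 : localInterior 0 = ∅ :=
        Finset.card_eq_zero.1 (Nat.le_zero.1 (by simpa using card_localInterior_le 0))
      rw [h0, Finset.sum_empty, norm_zero]
      simp
    · -- `η ≥ 0`, the face `(0, 0, 0)` being inside
      have hη : 0 ≤ η := by
        have hκ₀ : ((0 : ℤ), (0 : ℤ), (0 : Fin 2)) ∈ localInterior n :=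
          mem_localInterior.2 ⟨le_rfl, le_rfl, by
            simp only [Fin.val_zero, Nat.cast_zero, add_zero, zero_add]; exact_mod_cast hn⟩
        exact (abs_nonneg _).trans (h14 _ hκ₀ 0 0)
      calc ‖∑ κ ∈ localInterior n, ∑ j : Fin 3, (2 * triZeta - 1) * (triZeta ^ 2 *
            (localFaceCentre p s (localFaceNbr κ j) - localFaceCentre p s κ) *
              ((g (i + 1) κ (localFaceNbr κ (j + 1)) : ℂ) - g i κ (localFaceNbr κ j)))‖
          ≤ ∑ κ ∈ localInterior n, ∑ j : Fin 3, |s| * η :=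
            (norm_sum_le _ _).trans (Finset.sum_le_sum fun κ hκ =>
              (norm_sum_le _ _).trans (Finset.sum_le_sum fun j _ => hterm κ hκ j))
        _ = 3 * ((localInterior n).card : ℝ) * (|s| * η) := by
            simp only [Finset.sum_const, Finset.card_univ, Fintype.card_fin, nsmul_eq_mul,
              Nat.cast_ofNat]
            ring
        _ ≤ 3 * ((n : ℝ) ^ 2) * (|s| * η) :=
            mul_le_mul_of_nonneg_right
              (mul_le_mul_of_nonneg_left (by exact_mod_cast card_localInterior_le n)
                (by norm_num))
              (mul_nonneg (abs_nonneg s) hη)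
        _ = 3 * n ^ 2 * |s| * η := by ring
  -- (17) with (10): the inner sum is `c ∮ᴰ F^i`
  have h17 : ∀ i, Si i = hexRot * discreteTriangleIntegral (F i) p s n := by
    intro i
    have h1 := sum_innerPairs_eq p s n (fun z => (F i z : ℂ)) (fun κ κ' => (g i κ κ' : ℂ))
      (fun q hq => by
        rw [mem_innerPairs] at hq
        exact_mod_cast h10 q.1 hq.1 q.2 hq.2 i)
    have h0 := sum_localPairs_sub_mul_eq_zero p s n (fun z => (F i z : ℂ))
    rw [sum_localPairs_eq_inner_add_outer,
      sum_outerPairs_eq_hexRot_mul_discreteTriangleIntegral] at h0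
    have h2 : ∑ q ∈ innerPairs n, (localFaceCentre p s q.1 -
          localFaceCentre p s (localFaceNbr q.1 q.2)) * (F i (localFaceCentre p s q.1) : ℂ) =
        -∑ q ∈ innerPairs n, (localFaceCentre p s (localFaceNbr q.1 q.2) -
          localFaceCentre p s q.1) * (F i (localFaceCentre p s q.1) : ℂ) := by
      rw [← Finset.sum_neg_distrib]
      refine Finset.sum_congr rfl fun q _ => ?_
      ring
    simp only [hSi]
    rw [h1, h2]
    linear_combination -h0
  -- (16)
  have h16 : ∀ i, ‖(2 * triZeta - 1) * So i‖ ≤ 3 * n * |s| * ε := fun i =>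
    norm_mul_sum_outerPairs_le p s n (g i) (fun κ hκ j => h12 κ hκ i j)
  -- assembly: `∮ᴰ F^{i+1} - ω ∮ᴰ F^i = (2ζ - 1)(S_{i+1} - ω S_i) + (ω (2ζ - 1) S''_i - (2ζ - 1) S''_{i+1})`
  have hkey : discreteTriangleIntegral (F (i + 1)) p s n -
      triZeta ^ 2 * discreteTriangleIntegral (F i) p s n =
      (2 * triZeta - 1) * (S (i + 1) - triZeta ^ 2 * S i) +
        (triZeta ^ 2 * ((2 * triZeta - 1) * So i) - (2 * triZeta - 1) * So (i + 1)) := by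
    have hc := two_triZeta_sub_one_mul_hexRot
    have e1 := hsplit i
    have e2 := hsplit (i + 1)
    rw [h17] at e1 e2
    linear_combination (-(discreteTriangleIntegral (F (i + 1)) p s n) +
      triZeta ^ 2 * discreteTriangleIntegral (F i) p s n) * hc -
      (2 * triZeta - 1) * e2 + triZeta ^ 2 * (2 * triZeta - 1) * e1
  rw [hkey]
  calc ‖(2 * triZeta - 1) * (S (i + 1) - triZeta ^ 2 * S i) +
        (triZeta ^ 2 * ((2 * triZeta - 1) * So i) - (2 * triZeta - 1) * So (i + 1))‖
      ≤ ‖(2 * triZeta - 1) * (S (i + 1) - triZeta ^ 2 * S i)‖ +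
        ‖triZeta ^ 2 * ((2 * triZeta - 1) * So i) - (2 * triZeta - 1) * So (i + 1)‖ :=
        norm_add_le _ _
    _ ≤ 3 * n ^ 2 * |s| * η + (3 * n * |s| * ε + 3 * n * |s| * ε) := by
        refine add_le_add h15 ((norm_sub_le _ _).trans (add_le_add ?_ (h16 (i + 1))))
        rw [norm_mul, norm_pow, norm_triZeta, one_pow, one_mul]
        exact h16 i
    _ = 6 * n * |s| * ε + 3 * n ^ 2 * |s| * η := by ring

/-- **Bollobás–Riordan's Lemma 13 with a colour-switching defect, on `δ𝕋`.** Let `δ ≥ 0`, let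
`C : p → p + n s → p + n s ζ → p` (`p = triMeshPoint δ x₀`, `s = ± δ`) be a lattice triangular
contour of `δ𝕋` whose closed solid triangle lies in `K`, and let `F : Fin 3 → ℂ → ℝ` and
`g : Fin 3 → faces → faces → ℝ` satisfy, at every face `w` with centre `δ · hexCenter w ∈ K`
(opposite faces `z_j = oppFace w j`, anticlockwise): the APPROXIMATE (14)
`|g^{i+1}(w, z_{j+1}) - g^i(w, z_j)| ≤ η`; (10) `F^i(δ z_j) - F^i(δ w) = g^i(w, z_j) - g^i(z_j, w)`
whenever also `δ z_j ∈ K`; (12) `|g^i(w, z_j)| ≤ ε`. Then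
`‖∮ᴰ_C F^{i+1} dz - ω ∮ᴰ_C F^i dz‖ ≤ 6 n δ ε + 3 n² δ η`, `ω = ζ²` (Bollobás–Riordan 2006,
Lemma 13, pp. 181–182, with (14) weakened; the exact case `η = 0` is
`norm_discreteTriangleIntegral_sub_mul_le`). -/
theorem norm_discreteTriangleIntegral_sub_mul_le_approx {δ : ℝ} (hδ : 0 ≤ δ) (x₀ : Site 2)
    (n : ℕ) {s : ℝ} (hs : s = δ ∨ s = -δ) (F : Fin 3 → ℂ → ℝ)
    (g : Fin 3 → HexVertex → HexVertex → ℝ) {ε η : ℝ} {K : Set ℂ}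
    (hK : convexHull ℝ ({triMeshPoint δ x₀, triMeshPoint δ x₀ + n * s,
      triMeshPoint δ x₀ + n * s * triZeta} : Set ℂ) ⊆ K)
    (h14 : ∀ w : HexVertex, (δ : ℂ) * hexCenter w ∈ K → ∀ i j : Fin 3,
      |g (i + 1) w (oppFace w (j + 1)) - g i w (oppFace w j)| ≤ η)
    (h10 : ∀ w : HexVertex, (δ : ℂ) * hexCenter w ∈ K → ∀ j : Fin 3,
      (δ : ℂ) * hexCenter (oppFace w j) ∈ K → ∀ i : Fin 3,
        F i (δ * hexCenter (oppFace w j)) - F i (δ * hexCenter w) =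
          g i w (oppFace w j) - g i (oppFace w j) w)
    (h12 : ∀ w : HexVertex, (δ : ℂ) * hexCenter w ∈ K → ∀ i j : Fin 3,
      |g i w (oppFace w j)| ≤ ε)
    (i : Fin 3) :
    ‖discreteTriangleIntegral (F (i + 1)) (triMeshPoint δ x₀) s n -
        triZeta ^ 2 * discreteTriangleIntegral (F i) (triMeshPoint δ x₀) s n‖ ≤
      6 * n * δ * ε + 3 * n ^ 2 * δ * η := by
  -- the face map and its two compatibilities, uniformly in the sign of `s`
  obtain ⟨φ, hφn, hφc⟩ : ∃ φ : LocalFace → HexVertex,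
      (∀ κ j, φ (localFaceNbr κ j) = oppFace (φ κ) (j + faceShift (φ κ))) ∧
        ∀ κ, (δ : ℂ) * hexCenter (φ κ) = localFaceCentre (triMeshPoint δ x₀) s κ := by
    rcases hs with rfl | rfl
    · exact ⟨localToHex x₀, localToHex_nbr x₀, hexCenter_localToHex s x₀⟩
    · exact ⟨localToHexNeg x₀, localToHexNeg_nbr x₀, hexCenter_localToHexNeg δ x₀⟩
  have hsabs : |s| = δ := by
    rcases hs with rfl | rfl
    · exact abs_of_nonneg hδ
    · rw [abs_neg, abs_of_nonneg hδ]
  have hin : ∀ κ ∈ localInterior n, (δ : ℂ) * hexCenter (φ κ) ∈ K := fun κ hκ => by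
    rw [hφc]
    exact hK (localFaceCentre_mem_convexHull _ _ hκ)
  have := norm_discreteTriangleIntegral_sub_mul_le_local_approx F
    (fun i κ κ' => g i (φ κ) (φ κ')) (triMeshPoint δ x₀) s n (ε := ε) (η := η) ?_ ?_ ?_ i
  · rwa [hsabs] at this
  · intro κ hκ i j
    simp only [hφn, add_right_comm j 1 (faceShift (φ κ))]
    exact h14 (φ κ) (hin κ hκ) i (j + faceShift (φ κ))
  · intro κ hκ j hj i
    have hz : (δ : ℂ) * hexCenter (oppFace (φ κ) (j + faceShift (φ κ))) ∈ K := by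
      rw [← hφn]; exact hin _ hj
    have h := h10 (φ κ) (hin κ hκ) (j + faceShift (φ κ)) hz i
    rw [← hφn, hφc, hφc] at h
    exact h
  · intro κ hκ i j
    simp only [hφn]
    exact h12 (φ κ) (hin κ hκ) i (j + faceShift (φ κ))

/-- **Item `ApproxDiscreteCauchy` of route `CardyBondTriangular`, settled with `C = 3`:**
Bollobás–Riordan's Lemma 13 summation by parts with a colour-switching defect `η` per face —
the discrete Cauchy defect is at most `6 n δ ε + 3 n² δ η`
(`norm_discreteTriangleIntegral_sub_mul_le_approx`). -/
theorem approxDiscreteCauchy_proof :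
    Summit.CriticalPhenomena.CardyFormulaZ2.Theses.CardyBondTriangular.ApproxDiscreteCauchy := by
  unfold Summit.CriticalPhenomena.CardyFormulaZ2.Theses.CardyBondTriangular.ApproxDiscreteCauchy
  refine ⟨3, fun δ hδ x₀ n s hs F g ε η K hK h14 h10 h12 i => ?_⟩
  exact norm_discreteTriangleIntegral_sub_mul_le_approx hδ x₀ n hs F g hK h14 h10 h12 i

end Summit.CriticalPhenomena.CardyFormulaZ2.Theorems

end
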